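import Mathlib
import HarnessLib
import Literature.Analysis.FluidPDE.VectorCalculus
import Literature.Analysis.FluidPDE.Vorticity
import Literature.Analysis.FluidPDE.VorticityStretching
import Literature.Analysis.FluidPDE.SpaceTimeCalculus
import Literature.Analysis.FluidPDE.WholeSpaceIBP
import Literature.Analysis.FluidPDE.KNSSLemma31Caloric
import Literature.Analysis.FluidPDE.KinematicHubbleThreshold
import Literature.Analysis.FluidPDE.TaoAveragedNondegeneracy
import Literature.Analysis.FluidPDE.LocalHelmholtzSlice
import Literature.Analysis.FluidPDE.PeriodicBoxTorus

/-!
# Route UnthreadedDoor · crux `PoloidalLiouville` (stmt-NavierStokesRegularity-1222, shared with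
# route ThreadingFlux) · LINE «antidynamo» v2 — stub `stub_potentialEvolution` (2a-evo), file 1/2:
# THE CORE COMPUTATION of the exact evolution law of the toroidal potential

Seat ns-qj-p1 g3 (director-ns KEY-NS #137), `--supports stmt-NavierStokesRegularity-1222 --as helper`.
Registered skeleton of record: planner ns-idea-6 g5, `PoloidalLiouville_antidynamo_birth_v2.lean`
(sha16 `4ebf5683127baf3c`). The stub `StubPotentialEvolution` itself (potential smooth on the PUNCTURED
slab) is proved verbatim in the sequel `UnthreadedDoorPotentialEvolution.lean` by localisation; this file
carries the computation for a potential smooth on the WHOLE slab that represents the vorticity near the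
point:

  `cross_gradient_potential_of_local`: for a classical solution `v` of the vorticity formulation on
  `(−∞,0)` (`ν = 1`) and `Θ` jointly smooth on `(−∞,0) × ℝ³` with `curl v(s) = ∇Θ(s) × (· − x₀)` for all
  `s < 0` on a neighbourhood of `x`:
        `∇(∂ₜΘ + ⟪v, ∇Θ⟫ − ΔΘ) × (x − x₀) = ∇⟪v, x − x₀⟫ × ∇Θ`   at `(t, x)`, `t < 0`.        (E1)

PROOF (`y = x − x₀`, `a = ∇Θ(t,x)`, `V = v(t,x)`, `M = Dv(t,x)`, `H = D∇Θ(t,x)` the Hessian). The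
vorticity equation `∂ₜω + Dω[V] = Mω + Δω` (Majda–Bertozzi (2.110)) at `(t,x)` with `ω = ∇Θ × y` reads
      `∇Θₜ × y + (a × V + (HV) × y) = M(a × y) + ∇ΔΘ × y`:
`∂ₜ` passes onto `∇Θ` by Schwarz (tree `IsSmoothSpaceTimeOn.hasDerivAt_fderiv_slice`, coordinatewise),
`D(∇Θ × y)[V] = a × V + (HV) × y` (product rule, tree `hasFDerivAt_cross`), and
`Δ(∇Θ × y) = Δ∇Θ × y + 2Σᵢ ∂ᵢ∇Θ × eᵢ = ∇ΔΘ × y` (tree `laplacian_eq_sum_fderiv_fderiv`,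
`fderiv_laplacian_apply`; the sum vanishes by the symmetry of `H`, `fderiv_gradient_single_apply` +
`ContDiffAt.isSymmSndFDerivAt`). The claimed law expands (`fderiv_inner_apply`) to
`∇Θₜ × y + (Mᵀa + HV) × y − ∇ΔΘ × y = (Mᵀy + V) × a`, and the two differ exactly by the COFACTOR IDENTITY
      `(Mᵀa) × y + a × (Mᵀy) + M(a × y) = (tr M)(a × y)`,   `tr M = div v = 0`
(`cross_eq_of_vorticity_identity`: coordinates and `linear_combination`).

HONEST FRAMING: an exact identity for HYPOTHETICAL bounded ancient (blow-up profile) solutions; the line's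
wall (`stub_scalarLiouville`) is OPEN; nothing here bears on `PoloidalLiouville`, on the UnthreadedDoor
Target, or on Navier–Stokes regularity; no summit statement is proved here. [folklore]

References: A. J. Majda, A. L. Bertozzi, *Vorticity and Incompressible Flow* (CUP 2002) §1.1 (vector
identities), Prop. 2.4 eq. (2.110); G. Backus, Rev. Geophys. 24 (1986) §2 (Mie representation).
-/

noncomputable section

set_option linter.dupNamespace false

namespace Summit.NavierStokesRegularity.NavierStokesRegularity.Theorems.PoloidalLiouville

open MeasureTheory Set Function Filter
open _root_.Topology
open scoped RealInnerProductSpace InnerProductSpace ContDiff Laplacian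
open Literature.Analysis.FluidPDE

/-! ### Coordinates -/

/-- First coordinate of the cross product. [folklore] -/
theorem cross_apply_zero (a c : (EuclideanSpace ℝ (Fin 3))) : (cross a c) 0 = a 1 * c 2 - a 2 * c 1 := by
  simp [cross, cross_apply]

/-- Second coordinate of the cross product. [folklore] -/
theorem cross_apply_one (a c : (EuclideanSpace ℝ (Fin 3))) : (cross a c) 1 = a 2 * c 0 - a 0 * c 2 := by
  simp [cross, cross_apply]

/-- Third coordinate of the cross product. [folklore] -/
theorem cross_apply_two (a c : (EuclideanSpace ℝ (Fin 3))) : (cross a c) 2 = a 0 * c 1 - a 1 * c 0 := by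
  simp [cross, cross_apply]

/-- Coordinates of a gradient are partial derivatives: `(∇f(x))ᵢ = Df(x) eᵢ`. [folklore] -/
theorem gradient_coord (f : (EuclideanSpace ℝ (Fin 3)) → ℝ) (x : (EuclideanSpace ℝ (Fin 3))) (i : Fin 3) : gradient f x i = fderiv ℝ f x (EuclideanSpace.single i (1 : ℝ)) := by
  rw [← LocalHelmholtz.inner_gradient_left_eq_fderiv]
  simp only [EuclideanSpace.inner_single_right, one_mul, RCLike.conj_to_real]

/-! ### The algebra of the evolution law: the cofactor identity -/

/-- **The linear algebra behind the evolution law.** For a trace-free linear map `M` of `ℝ³` and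
vectors: if `P × y + (a × V + Q × y) = M (a × y) + R × y` (the vorticity equation, read with
`ω = a × y`), `Gᵢ = ⟪M eᵢ, a⟫ + ⟪V, Hᵢ⟫` (the gradient of `⟪v, ∇T⟫`), `Q_k = Σⱼ Vⱼ (Hⱼ)_k` (the
convective term `D(∇T)[v]`) with `H` symmetric (the Hessian), and `nᵢ = ⟪M eᵢ, y⟫ + Vᵢ` (the gradient of
`⟪v, y⟫`), then `(P + G − R) × y = n × a`. The difference of the two sides is the cofactor identity
`(Mᵀa) × y + a × (Mᵀy) + M(a × y) = (tr M)(a × y)`. [folklore] -/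
theorem cross_eq_of_vorticity_identity (M : (EuclideanSpace ℝ (Fin 3)) →L[ℝ] (EuclideanSpace ℝ (Fin 3))) (a y V P Q R G n : (EuclideanSpace ℝ (Fin 3))) (H : Fin 3 → (EuclideanSpace ℝ (Fin 3)))
    (htr : ∑ m, M (EuclideanSpace.single m (1 : ℝ)) m = 0)
    (hG : ∀ i, G i = ⟪M (EuclideanSpace.single i (1 : ℝ)), a⟫ + ⟪V, H i⟫)
    (hQ : ∀ k, Q k = ∑ j, V j * H j k)
    (hH : ∀ i j, H i j = H j i)
    (hn : ∀ i, n i = ⟪M (EuclideanSpace.single i (1 : ℝ)), y⟫ + V i)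
    (hVE : cross P y + (cross a V + cross Q y) = M (cross a y) + cross R y) :
    cross (P + G - R) y = cross n a := by
  have hc : ∀ w : (EuclideanSpace ℝ (Fin 3)), ∀ k : Fin 3, M w k = ∑ m, w m * M (EuclideanSpace.single m (1 : ℝ)) k := fun w k => clm_apply_coord M w k
  have h0 := congrArg (fun w : (EuclideanSpace ℝ (Fin 3)) => w 0) hVE
  have h1 := congrArg (fun w : (EuclideanSpace ℝ (Fin 3)) => w 1) hVE
  have h2 := congrArg (fun w : (EuclideanSpace ℝ (Fin 3)) => w 2) hVE
  simp only [PiLp.add_apply, hc (cross a y)] at h0 h1 h2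
  simp only [cross_apply_zero, cross_apply_one, cross_apply_two, Fin.sum_univ_three] at h0 h1 h2
  simp only [Fin.sum_univ_three] at htr
  have hG0 := hG 0; have hG1 := hG 1; have hG2 := hG 2
  have hn0 := hn 0; have hn1 := hn 1; have hn2 := hn 2
  have hQ0 := hQ 0; have hQ1 := hQ 1; have hQ2 := hQ 2
  simp only [Fin.sum_univ_three] at hQ0 hQ1 hQ2
  rw [Tao2016.real_inner_fin3, Tao2016.real_inner_fin3] at hG0 hG1 hG2
  rw [Tao2016.real_inner_fin3] at hn0 hn1 hn2
  have s01 := hH 0 1; have s02 := hH 0 2; have s12 := hH 1 2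
  refine PeriodicCylinder.ext3 ?_ ?_ ?_
  · rw [cross_apply_zero, cross_apply_zero]
    simp only [PiLp.add_apply, PiLp.sub_apply]
    rw [hG1, hG2, hn1, hn2]
    linear_combination h0 + (a 1 * y 2 - a 2 * y 1) * htr - y 2 * hQ1 + y 1 * hQ2
      - y 2 * V 0 * s01 + y 1 * V 0 * s02 + (y 2 * V 2 + y 1 * V 1) * s12
  · rw [cross_apply_one, cross_apply_one]
    simp only [PiLp.add_apply, PiLp.sub_apply]
    rw [hG0, hG2, hn0, hn2]
    linear_combination h1 + (a 2 * y 0 - a 0 * y 2) * htr - y 0 * hQ2 + y 2 * hQ0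
      - y 0 * V 1 * s12 - y 2 * V 1 * s01 - (y 0 * V 0 + y 2 * V 2) * s02
  · rw [cross_apply_two, cross_apply_two]
    simp only [PiLp.add_apply, PiLp.sub_apply]
    rw [hG0, hG1, hn0, hn1]
    linear_combination h2 + (a 0 * y 1 - a 1 * y 0) * htr - y 1 * hQ0 + y 0 * hQ1
      + y 1 * V 2 * s02 - y 0 * V 2 * s12 + (y 1 * V 1 + y 0 * V 0) * s01


/-- The gradient of a `C^∞` scalar function on `ℝ³` is `C^∞` (Riesz isometry after `fderiv`). [folklore] -/
theorem contDiff_gradient_top {θ : (EuclideanSpace ℝ (Fin 3)) → ℝ} (hθ : ContDiff ℝ ∞ θ) : ContDiff ℝ ∞ (gradient θ) := by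
  have e : gradient θ = fun z => (InnerProductSpace.toDual ℝ (EuclideanSpace ℝ (Fin 3))).symm (fderiv ℝ θ z) := rfl
  rw [e]
  exact (InnerProductSpace.toDual ℝ (EuclideanSpace ℝ (Fin 3))).symm.contDiff.comp (contDiff_infty_iff_fderiv.1 hθ).2

/-! ### The core computation (potential smooth on the whole slab, representation near `x`) -/

variable {v : ℝ → (EuclideanSpace ℝ (Fin 3)) → (EuclideanSpace ℝ (Fin 3))}

/-- **The evolution law, core form.** Let `v` solve the vorticity formulation on `(−∞,0)` (unit
viscosity) and let `Θ` be jointly smooth on `(−∞,0) × ℝ³` with `curl v(s) = ∇Θ(s) × (· − x₀)` for all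
`s < 0` on a neighbourhood `N` of `x`. Then at `(t, x)`, `t < 0`:
`∇(∂ₜΘ + ⟪v, ∇Θ⟫ − ΔΘ) × (x − x₀) = ∇⟪v, · − x₀⟫ × ∇Θ`.
Proof: the vorticity equation `∂ₜω + Dω[v] = Dv[ω] + Δω` at `(t,x)` with `ω = ∇Θ × y` reads
`∇Θₜ × y + (∇Θ × v + (D∇Θ v) × y) = Dv(∇Θ × y) + ∇ΔΘ × y` (`∂ₜ` and `Δ` pass onto `∇Θ`: Schwarz;
the term `2Σᵢ ∂ᵢ∇Θ × eᵢ` of `Δ(∇Θ × y)` vanishes by the symmetry of the Hessian), and the claimed law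
differs from it by the cofactor identity `(Mᵀa) × y + a × (Mᵀy) + M(a × y) = (tr M)(a × y)` with
`M = Dv`, `tr M = div v = 0` (`cross_eq_of_vorticity_identity`). [folklore] -/
theorem cross_gradient_potential_of_local {Θ : ℝ → (EuclideanSpace ℝ (Fin 3)) → ℝ} {x x₀ : (EuclideanSpace ℝ (Fin 3))} {t : ℝ} {N : Set (EuclideanSpace ℝ (Fin 3))}
    (hV : IsVorticitySolutionOn (Iio 0) 1 v) (hΘ : IsSmoothSpaceTimeOn (Iio 0) Θ) (ht : t < 0)
    (hN : N ∈ 𝓝 x) (hrep : ∀ s < 0, ∀ z ∈ N, curl (v s) z = cross (gradient (Θ s) z) (z - x₀)) :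
    cross (gradient (fun z => deriv (fun s => Θ s z) t + ⟪v t z, gradient (Θ t) z⟫ - (Δ (Θ t)) z) x)
        (x - x₀) =
      cross (gradient (fun z => ⟪v t z, z - x₀⟫) x) (gradient (Θ t) x) := by
  have hS : IsOpen (Iio (0 : ℝ)) := isOpen_Iio
  have ht' : t ∈ Iio (0 : ℝ) := ht
  have hxN : x ∈ N := mem_of_mem_nhds hN
  set b := EuclideanSpace.basisFun (Fin 3) ℝ with hb_def
  have hb : ∀ i, b i = EuclideanSpace.single i (1 : ℝ) := fun i => by simp [hb_def]
  -- the slices at time `t`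
  set θ : (EuclideanSpace ℝ (Fin 3)) → ℝ := Θ t with hθ_def
  set u : (EuclideanSpace ℝ (Fin 3)) → (EuclideanSpace ℝ (Fin 3)) := v t with hu_def
  set y : (EuclideanSpace ℝ (Fin 3)) := x - x₀ with hy_def
  set Θₜ : (EuclideanSpace ℝ (Fin 3)) → ℝ := fun z => deriv (fun s => Θ s z) t with hΘₜ_def
  have hθ : ContDiff ℝ ∞ θ := hΘ.contDiff_slice ht'
  have hu : ContDiff ℝ ∞ u := hV.smooth_velocity.contDiff_slice ht'
  have hΘₜ : ContDiff ℝ ∞ Θₜ := (hΘ.isSmoothSpaceTimeOn_deriv hS).contDiff_slice ht'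
  have hθ2 : ContDiff ℝ 2 θ := hθ.of_le (by norm_cast)
  have hθ3 : ContDiff ℝ 3 θ := hθ.of_le (by norm_cast)
  set A : (EuclideanSpace ℝ (Fin 3)) → (EuclideanSpace ℝ (Fin 3)) := gradient θ with hA_def
  have hA : ContDiff ℝ ∞ A := contDiff_gradient_top hθ
  have hA2 : ContDiff ℝ 2 A := hA.of_le (by norm_cast)
  have hAd : Differentiable ℝ A := hA.differentiable (by simp)
  have hud : Differentiable ℝ u := hu.differentiable (by simp)
  -- the partial derivatives of `A`
  have hAi : ∀ c : (EuclideanSpace ℝ (Fin 3)), ContDiff ℝ 1 fun z => fderiv ℝ A z c := fun c =>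
    (hA2.fderiv_right (m := 1) le_rfl).clm_apply contDiff_const
  -- the point data
  set a : (EuclideanSpace ℝ (Fin 3)) := A x with ha_def
  set V : (EuclideanSpace ℝ (Fin 3)) := u x with hV_def
  set M : (EuclideanSpace ℝ (Fin 3)) →L[ℝ] (EuclideanSpace ℝ (Fin 3)) := fderiv ℝ u x with hM_def
  set H : Fin 3 → (EuclideanSpace ℝ (Fin 3)) := fun i => fderiv ℝ A x (EuclideanSpace.single i (1 : ℝ)) with hH_def
  set Q : (EuclideanSpace ℝ (Fin 3)) := fderiv ℝ A x V with hQ_def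
  set P : (EuclideanSpace ℝ (Fin 3)) := gradient Θₜ x with hP_def
  set R : (EuclideanSpace ℝ (Fin 3)) := gradient (Δ θ) x with hR_def
  set G : (EuclideanSpace ℝ (Fin 3)) := gradient (fun z => ⟪u z, A z⟫) x with hG_def
  set n : (EuclideanSpace ℝ (Fin 3)) := gradient (fun z => ⟪u z, z - x₀⟫) x with hn_def
  -- (tr) `tr M = div v(t)(x) = 0`
  have htr : ∑ m, M (EuclideanSpace.single m (1 : ℝ)) m = 0 := by
    have h := hV.divFree t ht' x
    rw [VectorCalculus.divergence, trace_eq_sum_coord] at h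
    exact h
  -- (H) the Hessian is symmetric
  have hH : ∀ i j, H i j = H j i := by
    intro i j
    have hsymm : IsSymmSndFDerivAt ℝ θ x := hθ2.contDiffAt.isSymmSndFDerivAt (by simp)
    simp only [hH_def, hA_def]
    rw [fderiv_gradient_single_apply θ hθ2 x j i, fderiv_gradient_single_apply θ hθ2 x i j]
    exact hsymm.eq _ _
  -- (Q) `Q = Σⱼ Vⱼ Hⱼ`
  have hQ : ∀ k, Q k = ∑ j, V j * H j k := fun k => clm_apply_coord (fderiv ℝ A x) V k
  -- (G) `∇⟪u, A⟫ = Mᵀ a + H V`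
  have hG : ∀ i, G i = ⟪M (EuclideanSpace.single i (1 : ℝ)), a⟫ + ⟪V, H i⟫ := by
    intro i
    rw [hG_def, gradient_coord, fderiv_inner_apply ℝ (hud x) (hAd x)]
    simp only [hM_def, ha_def, hV_def, hH_def]
    ring
  -- (n) `∇⟪u, y⟫ = Mᵀ y + V`
  have hn : ∀ i, n i = ⟪M (EuclideanSpace.single i (1 : ℝ)), y⟫ + V i := by
    intro i
    have hid : DifferentiableAt ℝ (fun z : (EuclideanSpace ℝ (Fin 3)) => z - x₀) x := differentiableAt_id.sub_const x₀
    rw [hn_def, gradient_coord, fderiv_inner_apply ℝ (hud x) hid, fderiv_sub_const, fderiv_fun_id]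
    simp only [ContinuousLinearMap.coe_id', id_eq, hM_def, hV_def, hy_def,
      EuclideanSpace.inner_single_right, one_mul, RCLike.conj_to_real]
    ring
  -- ### the representation near `x` at time `t`, and the derivative of such fields
  set W : (EuclideanSpace ℝ (Fin 3)) → (EuclideanSpace ℝ (Fin 3)) := fun z => cross (A z) (z - x₀) with hW_def
  have hWeq : curl u =ᶠ[𝓝 x] W := by
    filter_upwards [hN] with z hz
    exact hrep t ht z hz
  have hcurlx : curl u x = cross a y := hrep t ht x hxN
  have hDcross : ∀ (B : (EuclideanSpace ℝ (Fin 3)) → (EuclideanSpace ℝ (Fin 3))), Differentiable ℝ B → ∀ z w : (EuclideanSpace ℝ (Fin 3)),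
      fderiv ℝ (fun z => cross (B z) (z - x₀)) z w = cross (B z) w + cross (fderiv ℝ B z w) (z - x₀) := by
    intro B hB z w
    rw [(hasFDerivAt_cross (hB z).hasFDerivAt (hasFDerivAt_sub_const x₀)).fderiv]
    simp only [_root_.add_apply, ContinuousLinearMap.precompR_apply,
      ContinuousLinearMap.compL_apply, ContinuousLinearMap.coe_comp, Function.comp_apply,
      ContinuousLinearMap.precompL_apply, crossCLM_apply, ContinuousLinearMap.coe_id', id_eq]
  -- ### (T1) the time derivative: `∂ₜ ω(t, x) = ∇Θₜ(x) × y`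
  have hω : IsSmoothSpaceTimeOn (Iio (0 : ℝ)) (vorticity v) := by
    have e : vorticity v = fun s z => curlCLM (fderiv ℝ (v s) z) := by
      funext s z; rfl
    rw [e]
    exact (hV.smooth_velocity.fderiv_slice hS.uniqueDiffOn).clm curlCLM
  have hT1 : deriv (fun s => curl (v s) x) t = cross P y := by
    have hc : HasDerivAt (fun s => curl (v s) x) (deriv (fun s => curl (v s) x) t) t :=
      hω.hasDerivAt_timeLine hS ht' x
    have hPj : ∀ j : Fin 3, HasDerivAt (fun s => fderiv ℝ (Θ s) x (EuclideanSpace.single j (1 : ℝ))) (P j) t := by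
      intro j
      rw [hP_def, gradient_coord]
      exact hΘ.hasDerivAt_fderiv_slice hS ht' x (EuclideanSpace.single j (1 : ℝ))
    have hci : ∀ i : Fin 3,
        HasDerivAt (fun s => curl (v s) x i) (deriv (fun s => curl (v s) x) t i) t := fun i => by
      have h := (EuclideanSpace.proj i).hasFDerivAt.comp_hasDerivAt t hc
      simpa [Function.comp_def] using h
    have hev : ∀ᶠ s in 𝓝 t, curl (v s) x = cross (gradient (Θ s) x) y := by
      filter_upwards [hS.mem_nhds ht'] with s hs
      exact hrep s hs x hxN
    have e0 : deriv (fun s => curl (v s) x) t 0 = (cross P y) 0 := by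
      have h1 : HasDerivAt (fun s => fderiv ℝ (Θ s) x (EuclideanSpace.single 1 (1 : ℝ)) * y 2 - fderiv ℝ (Θ s) x (EuclideanSpace.single 2 (1 : ℝ)) * y 1)
          (P 1 * y 2 - P 2 * y 1) t := ((hPj 1).mul_const _).sub ((hPj 2).mul_const _)
      have h2 : (fun s => curl (v s) x 0) =ᶠ[𝓝 t]
          fun s => fderiv ℝ (Θ s) x (EuclideanSpace.single 1 (1 : ℝ)) * y 2 - fderiv ℝ (Θ s) x (EuclideanSpace.single 2 (1 : ℝ)) * y 1 := by
        filter_upwards [hev] with s hs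
        rw [hs, cross_apply_zero, gradient_coord, gradient_coord]
      rw [cross_apply_zero, ← (hci 0).deriv, h2.deriv_eq, h1.deriv]
    have e1 : deriv (fun s => curl (v s) x) t 1 = (cross P y) 1 := by
      have h1 : HasDerivAt (fun s => fderiv ℝ (Θ s) x (EuclideanSpace.single 2 (1 : ℝ)) * y 0 - fderiv ℝ (Θ s) x (EuclideanSpace.single 0 (1 : ℝ)) * y 2)
          (P 2 * y 0 - P 0 * y 2) t := ((hPj 2).mul_const _).sub ((hPj 0).mul_const _)
      have h2 : (fun s => curl (v s) x 1) =ᶠ[𝓝 t]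
          fun s => fderiv ℝ (Θ s) x (EuclideanSpace.single 2 (1 : ℝ)) * y 0 - fderiv ℝ (Θ s) x (EuclideanSpace.single 0 (1 : ℝ)) * y 2 := by
        filter_upwards [hev] with s hs
        rw [hs, cross_apply_one, gradient_coord, gradient_coord]
      rw [cross_apply_one, ← (hci 1).deriv, h2.deriv_eq, h1.deriv]
    have e2 : deriv (fun s => curl (v s) x) t 2 = (cross P y) 2 := by
      have h1 : HasDerivAt (fun s => fderiv ℝ (Θ s) x (EuclideanSpace.single 0 (1 : ℝ)) * y 1 - fderiv ℝ (Θ s) x (EuclideanSpace.single 1 (1 : ℝ)) * y 0)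
          (P 0 * y 1 - P 1 * y 0) t := ((hPj 0).mul_const _).sub ((hPj 1).mul_const _)
      have h2 : (fun s => curl (v s) x 2) =ᶠ[𝓝 t]
          fun s => fderiv ℝ (Θ s) x (EuclideanSpace.single 0 (1 : ℝ)) * y 1 - fderiv ℝ (Θ s) x (EuclideanSpace.single 1 (1 : ℝ)) * y 0 := by
        filter_upwards [hev] with s hs
        rw [hs, cross_apply_two, gradient_coord, gradient_coord]
      rw [cross_apply_two, ← (hci 2).deriv, h2.deriv_eq, h1.deriv]
    exact PeriodicCylinder.ext3 e0 e1 e2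
  -- ### (T2) the convective term: `Dω(x)[V] = a × V + (D∇Θ V) × y`
  have hT2 : fderiv ℝ (curl u) x V = cross a V + cross Q y := by
    rw [hWeq.fderiv_eq]
    exact hDcross A hAd x V
  -- ### (T4) the Laplacian: `Δω(x) = ∇(Δθ)(x) × y`
  have hT4 : (Δ (curl u)) x = cross R y := by
    rw [(InnerProductSpace.laplacian_congr_nhds hWeq).eq_of_nhds]
    have hW : ContDiff ℝ 2 W :=
      (crossCLM.contDiff.comp hA2).clm_apply (contDiff_id.sub contDiff_const)
    rw [laplacian_eq_sum_fderiv_fderiv b hW x]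
    -- second derivatives at `x`
    have hD2 : ∀ i, fderiv ℝ (fun z => fderiv ℝ W z (b i)) x (b i) =
        cross (fderiv ℝ A x (b i)) (b i) + (cross (fderiv ℝ A x (b i)) (b i) +
          cross (fderiv ℝ (fun z => fderiv ℝ A z (b i)) x (b i)) (x - x₀)) := by
      intro i
      have hD1 : (fun z => fderiv ℝ W z (b i)) =
          fun z => cross (A z) (b i) + cross (fderiv ℝ A z (b i)) (z - x₀) := by
        funext z; exact hDcross A hAd z (b i)
      rw [hD1]
      have hf1 : DifferentiableAt ℝ (fun z => cross (A z) (b i)) x :=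
        (hasFDerivAt_cross (hAd x).hasFDerivAt (hasFDerivAt_const (b i) x)).differentiableAt
      have hB : Differentiable ℝ (fun z => fderiv ℝ A z (b i)) :=
        (hAi (b i)).differentiable one_ne_zero
      have hf2 : DifferentiableAt ℝ (fun z => cross (fderiv ℝ A z (b i)) (z - x₀)) x :=
        (hasFDerivAt_cross (hB x).hasFDerivAt (hasFDerivAt_sub_const x₀)).differentiableAt
      rw [fderiv_fun_add hf1 hf2, _root_.add_apply]
      have e1 : fderiv ℝ (fun z => cross (A z) (b i)) x (b i) = cross (fderiv ℝ A x (b i)) (b i) := by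
        rw [(hasFDerivAt_cross (hAd x).hasFDerivAt (hasFDerivAt_const (b i) x)).fderiv]
        simp only [_root_.add_apply, ContinuousLinearMap.precompR_apply,
          ContinuousLinearMap.compL_apply, ContinuousLinearMap.coe_comp, Function.comp_apply,
          ContinuousLinearMap.precompL_apply, crossCLM_apply, _root_.zero_apply,
          cross_zero_right, zero_add]
      rw [e1, hDcross _ hB x (b i)]
    rw [Finset.sum_congr rfl fun i _ => hD2 i, Finset.sum_add_distrib, Finset.sum_add_distrib]
    -- `Σᵢ ∂ᵢ∂ᵢ A = ΔA = ∇Δθ`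
    have hΔA : ∑ i, fderiv ℝ (fun z => fderiv ℝ A z (b i)) x (b i) = R := by
      rw [← laplacian_eq_sum_fderiv_fderiv b hA2 x]
      have hk : ∀ k : Fin 3, (Δ A) x k = R k := by
        intro k
        have h1 := hA2.contDiffAt.laplacian_CLM_comp_left (l := EuclideanSpace.proj k) (x := x)
        have h2 : (⇑(EuclideanSpace.proj k) ∘ A) = fun z => fderiv ℝ θ z (EuclideanSpace.single k (1 : ℝ)) := by
          funext z
          simp only [Function.comp_apply, hA_def]
          rw [← gradient_coord]
          rfl
        rw [h2] at h1
        have h3 : (Δ A) x k = (Δ fun z => fderiv ℝ θ z (EuclideanSpace.single k (1 : ℝ))) x := by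
          rw [h1]; rfl
        rw [h3, ← fderiv_laplacian_apply hθ3 x (EuclideanSpace.single k (1 : ℝ)), hR_def, gradient_coord]
      exact PeriodicCylinder.ext3 (hk 0) (hk 1) (hk 2)
    have hsumY : ∑ i, cross (fderiv ℝ (fun z => fderiv ℝ A z (b i)) x (b i)) (x - x₀) = cross R y := by
      rw [← hΔA]
      simp only [← crossCLM_apply]
      rw [map_sum, _root_.sum_apply]
    -- `Σᵢ ∂ᵢA × eᵢ = 0` (symmetry of the Hessian)
    have hsumX : ∑ i, cross (fderiv ℝ A x (b i)) (b i) = 0 := by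
      have s01 : fderiv ℝ A x (EuclideanSpace.single 0 (1 : ℝ)) 1 = fderiv ℝ A x (EuclideanSpace.single 1 (1 : ℝ)) 0 := hH 0 1
      have s02 : fderiv ℝ A x (EuclideanSpace.single 0 (1 : ℝ)) 2 = fderiv ℝ A x (EuclideanSpace.single 2 (1 : ℝ)) 0 := hH 0 2
      have s12 : fderiv ℝ A x (EuclideanSpace.single 1 (1 : ℝ)) 2 = fderiv ℝ A x (EuclideanSpace.single 2 (1 : ℝ)) 1 := hH 1 2
      simp only [Fin.sum_univ_three, hb]
      refine PeriodicCylinder.ext3 ?_ ?_ ?_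
      · simp only [PiLp.add_apply, cross_apply_zero, PiLp.zero_apply]
        simp
        linarith
      · simp only [PiLp.add_apply, cross_apply_one, PiLp.zero_apply]
        simp
        linarith
      · simp only [PiLp.add_apply, cross_apply_two, PiLp.zero_apply]
        simp
        linarith
    rw [hsumX, hsumY, zero_add, zero_add]
  -- ### the gradient of `F = Θₜ + ⟪u, A⟫ − Δθ`
  have hgradF : gradient (fun z => Θₜ z + ⟪u z, A z⟫ - (Δ θ) z) x = P + G - R := by
    have hd1 : DifferentiableAt ℝ Θₜ x := (hΘₜ.differentiable (by simp)) x
    have hd2 : DifferentiableAt ℝ (fun z => ⟪u z, A z⟫) x :=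
      ((hu.inner ℝ hA).differentiable (by simp)) x
    have hd3 : DifferentiableAt ℝ (Δ θ) x :=
      ((contDiff_laplacian_of_contDiff_infty hθ).differentiable (by simp)) x
    simp only [hP_def, hG_def, hR_def, gradient]
    rw [fderiv_fun_sub (f := fun z => Θₜ z + ⟪u z, A z⟫) (hd1.add hd2) hd3,
      fderiv_fun_add hd1 hd2, map_sub, map_add]
  -- ### the vorticity equation at `(t, x)` and the algebra
  have heq := hV.vorticity_eq t ht' x
  rw [timeDerivWithin_eq_deriv hS ht', one_smul] at heq
  simp only [vorticity_apply, convect_apply] at heq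
  rw [hT1, hT2, hcurlx, hT4] at heq
  have hmain := cross_eq_of_vorticity_identity M a y V P Q R G n H htr hG hQ hH hn heq
  have hF : (fun z => deriv (fun s => Θ s z) t + ⟪v t z, gradient (Θ t) z⟫ - (Δ (Θ t)) z) =
      fun z => Θₜ z + ⟪u z, A z⟫ - (Δ θ) z := rfl
  rw [hF, hgradF]
  exact hmain

end Summit.NavierStokesRegularity.NavierStokesRegularity.Theorems.PoloidalLiouville

end
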